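import Summits.AtomisticToContinuum.BoseEinsteinCondensation.Theses.BECHeatBathGap
import Summits.AtomisticToContinuum.BoseEinsteinCondensation.Theorems.BECInsertionCorrectorDirichletRemovalBound
import Summits.AtomisticToContinuum.BoseEinsteinCondensation.Theorems.BECHeatBathGapSomeNearMinimiserCondenses
import HarnessLib

/-!
# AtomisticToContinuum / BoseEinsteinCondensation — route `BECHeatBathGap`, assembly

Settles the assembly item `stmt-AtomisticToContinuum-15148` of route
`route-AtomisticToContinuum-BECHeatBathGap`: the support-free frame statement
`ParticleTensorisation → SquareSummableInfluence → GroundStateRigidity → BoseEinsteinCondensation`.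

It is the route's deciding theorem `closes` (hypotheses: the three cruxes `ParticleTensorisation`
(A1), `SquareSummableInfluence` (A2), `GroundStateRigidity`, plus the supports
`DirichletRemovalBound` and `TensorisedIncrement`) with its two support hypotheses discharged by the
landed proofs `heatBathGap_dirichletRemovalBound_proof`
(`Theorems/BECInsertionCorrectorDirichletRemovalBound.lean`, item stmt-AtomisticToContinuum-12061)
and `tensorisedIncrement_proof` (`Theorems/BECHeatBathGapSomeNearMinimiserCondenses.lean`, item
stmt-AtomisticToContinuum-14370). Pure logic; no analytic content lives here.
-/

namespace Summit.AtomisticToContinuum.BoseEinsteinCondensation.Theorems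

/-- Settles `stmt-AtomisticToContinuum-15148` (exact signature): the assembly of route
`BECHeatBathGap`, i.e. heat-bath approximate tensorisation of `|Θ_N|²` over particle labels (A1),
square-summable one-particle influence on the insertion amplitude (A2) and fixed-`N` phase rigidity
imply the sub-problem statement `BoseEinsteinCondensation`. Proof: the deciding theorem `closes`
fed with the proved supports `DirichletRemovalBound` and `TensorisedIncrement`. [folklore] -/
theorem becHeatBathGap_assembly_proof :
    Summit.AtomisticToContinuum.BoseEinsteinCondensation.Theses.BECHeatBathGap.Assembly := by
  unfold Theses.BECHeatBathGap.Assembly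
  intro h₁ h₂ h₃
  exact Theses.BECHeatBathGap.closes h₁ h₂ h₃ heatBathGap_dirichletRemovalBound_proof
    tensorisedIncrement_proof

end Summit.AtomisticToContinuum.BoseEinsteinCondensation.Theorems
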